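import Literature.NumberTheory.Sieve.LinearEquationsInPrimesTransference
import HarnessLib

/-!
# Linear equations in primes: normal form and the `W`-tricked reductions (Green–Tao 2010, §§4–5, §7)

Trunk T-SIEVE (`Literature/NumberTheory/Sieve`). Second layer of the decomposition of
`Literature.NumberTheory.Sieve.GreenTaoZiegler2012_finiteComplexity` (see `LinearEquationsInPrimesTransference.lean` for
the top layer): the single implication `Literature.NumberTheory.Sieve.GreenTao2010_transference` ("the Gowers uniformity
estimate Thm. 7.2 implies the Main Theorem") is split along the printed chain of reductions of
B. Green, T. Tao, *Linear equations in primes*, Ann. of Math. 171 (2010), §§4–5 and §7: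

  Main Theorem ⇐ Thm. 4.5 (`s`-normal form) ⇐ Thm. 5.1 (`W`-tricked primes)
    ⇐ Thm. 5.2 (product form) ⇐ Thm. 7.2 (Gowers uniformity of `Λ'_{b,W} - 1`).

Contents:
* `Literature.IsNormalForm s Ψ` — Def. 4.2 (`s`-normal form);
* the *conclusions* of Thms. 4.5, 5.1, 5.2 at level `s`, as `Prop`-valued definitions
  `Literature.GreenTao2010_mainNormalFormAt s`, `Literature.GreenTao2010_wTrickedAt s`,
  `Literature.GreenTao2010_wTrickedProductAt s` (in the paper these are theorems conditional on
  `GI(s)`, `MN(s)`, both now known; here they are the nodes of the DAG), and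
  `Literature.GreenTao2010_gowersUniformityAt s` (the level-`s` slice of
  `Literature.NumberTheory.Sieve.GreenTao2010_gowersUniformity`, Thm. 7.2);
* the four printed reductions as named facts:
  `Literature.NumberTheory.Sieve.GreenTao2010_main_of_mainNormalForm` (§4), `Literature.NumberTheory.Sieve.GreenTao2010_mainNormalForm_of_wTricked`
  (§5, pp. 1775–1776), `Literature.NumberTheory.Sieve.GreenTao2010_wTrickedProduct_of_gowersUniformity` (§7, via
  Props. 6.4 and 7.1) — and the reduction Thm. 5.2 ⇒ Thm. 5.1 ("splitting each `Λ'_{bᵢ,W}` as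
  `(Λ'_{bᵢ,W} - 1) + 1`, expanding out the product and using Theorem 5.2 repeatedly, noting that
  any subsystem of `Ψ` will still be in `s`-normal form"), which is PROVED here:
  `Literature.NumberTheory.Sieve.GreenTao2010_wTricked_of_wTrickedProduct`;
* the assembly `Literature.NumberTheory.Sieve.GreenTao2010_transference_of_reductions` (proved): the three remaining facts
  imply `GreenTao2010_transference`, hence (with `GreenTao2010_gowersUniformity`) the
  Green–Tao–Ziegler theorem (`Literature.NumberTheory.Sieve.GreenTaoZiegler2012_finiteComplexity_of_reductions`).

## Rendering conventions (as in the two parent files)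

* `o(N^d)` is uniform in `Ψ` for fixed `d, t, s, L` (§3, "Important convention"), in `K`, and in
  the residues `b₁, …, b_t` (Remark after Thm. 5.1): `∀ ε > 0, ∃ N₀, ∀ N ≥ N₀, ∀ Ψ, K, b, |…| ≤ ε N^d`.
* The cutoff `w` of the `W`-trick is rendered range-uniformly (`w₀ ≤ w ≤ ½ log log N`,
  `W = primorial w`), see the design notes of `LinearEquationsInPrimesTransference.lean`; the
  proof of the Main Theorem from Thm. 5.1 applies Thm. 5.1 at the scale `Ñ = O(N/W)` with the
  modulus of the scale `N`, and the proof of Thm. 5.2 from Thm. 7.2 enlarges `N` by a factor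
  `O(1)`; both stay inside the range form.
* Thms. 4.1, 4.5, 5.1, 5.2 print `K ⊆ [-N,N]^t`; since `Ψ : ℤ^d → ℤ^t` and the sums run over
  `K ∩ ℤ^d`, this is `K ⊆ [-N,N]^d` (as in Conj. 1.2 and Prop. 7.1).
* "`ψ₁, …, ψ_t > N^θ` on `K`" refers to the real extensions of the forms on the convex body `K`.
* Thm. 4.5 is printed for systems "of complexity `s` in `s`-normal form"; a system in `s`-normal
  form automatically has complexity `≤ s` (§4, sentence after Def. 4.2), and the printed deduction
  of Thm. 4.5 from Thm. 5.1 uses only the normal form, so we state the level-`s` normal-form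
  statement without a separate complexity hypothesis (this is what the reduction of the Main
  Theorem consumes, applied to the extension of Lemma 4.4). The standing hypotheses of Def. 1.1
  (`IsNondegenerateSystem`) are kept throughout.
* `Λ'_{b,W}` lives on `ℤ⁺`; the forms are `> N^{7/10} > 0` on `K`, so reading `ψᵢ(n)` through
  `Int.toNat` is faithful.

## References

* B. Green, T. Tao, *Linear equations in primes*, Ann. of Math. (2) 171 (2010), 1753–1850
  (arXiv:math/0606088): Def. 1.1, Lemma 1.6, §3, Thm. 4.1, Def. 4.2, Def. 4.3, Lemma 4.4,
  Thm. 4.5 and "Proof of the Main Theorem assuming Theorem 4.5", §5 (Thm. 5.1, "Proof of the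
  Main Theorem assuming Theorem 5.1", Thm. 5.2 and the paragraph following it), Prop. 6.4,
  Prop. 7.1, Thm. 7.2 and "Proof of Main Theorem assuming Theorem 7.2".
* B. Green, T. Tao, T. Ziegler, *An inverse theorem for the Gowers `U^{s+1}[N]`-norm*, Ann. of
  Math. (2) 176 (2012), 1231–1372, Thm. 1.3 and the paragraph following it.
-/

noncomputable section

open Filter Finset
open scoped Topology

namespace Literature.NumberTheory.Sieve

variable {d t : ℕ}

/-! ### Normal form (Green–Tao 2010, Def. 4.2) -/

/-- **`s`-normal form** (Green–Tao 2010, Def. 4.2, as printed): "Let `Ψ = (ψ₁, …, ψ_t)` be a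
system of affine-linear forms on `ℤ^d`, and let `s ≥ 0`. We say that `Ψ` is in `s`-normal form
if for every `i ∈ [t]`, there exists a collection `Jᵢ ⊆ {e₁, …, e_d}` of basis vectors of
cardinality `|Jᵢ| ≤ s + 1` such that `∏_{e ∈ Jᵢ} ψ̇_{i'}(e)` is non-zero for `i' = i` and
vanishes otherwise." (Basis vectors are indexed by `Fin d`; `ψ̇ᵢ(e_j) = (Ψ i).coeff j`.)
[cite: GreenTao2010, Def. 4.2] -/
def IsNormalForm (s : ℕ) (Ψ : Fin t → AffLinForm d) : Prop :=
  ∀ i : Fin t, ∃ J : Finset (Fin d), J.card ≤ s + 1 ∧ (∏ e ∈ J, (Ψ i).coeff e) ≠ 0 ∧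
    ∀ i' : Fin t, i' ≠ i → ∏ e ∈ J, (Ψ i').coeff e = 0

/-- An `s`-normal form is an `s'`-normal form for every `s' ≥ s` (the same `Jᵢ`). [folklore] -/
theorem IsNormalForm.mono {s s' : ℕ} {Ψ : Fin t → AffLinForm d} (h : IsNormalForm s Ψ)
    (hs : s ≤ s') : IsNormalForm s' Ψ := by
  intro i
  obtain ⟨J, hJ, h1, h2⟩ := h i
  exact ⟨J, hJ.trans (by omega), h1, h2⟩

/-- "If `Ψ = (ψᵢ)` is in `s`-normal form, then so is any subsystem `(ψᵢ)_{i ∈ I}`" (here: the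
reindexing of `Ψ` along any injection of index sets). [cite: GreenTao2010, §4 (after Def. 4.3)] -/
theorem IsNormalForm.comp_of_injective {s k : ℕ} {Ψ : Fin t → AffLinForm d}
    (h : IsNormalForm s Ψ) {e : Fin k → Fin t} (he : Function.Injective e) :
    IsNormalForm s (Ψ ∘ e) := by
  intro j
  obtain ⟨J, hJ, h1, h2⟩ := h (e j)
  exact ⟨J, hJ, h1, fun j' hj' => h2 (e j') fun hh => hj' (he hh)⟩

/-- Subsystems of a system satisfying the standing hypotheses of Def. 1.1 satisfy them.
[cite: GreenTao2010, Def. 1.1] -/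
theorem IsNondegenerateSystem.comp_of_injective {k : ℕ} {Ψ : Fin t → AffLinForm d}
    (h : IsNondegenerateSystem Ψ) {e : Fin k → Fin t} (he : Function.Injective e) :
    IsNondegenerateSystem (Ψ ∘ e) :=
  ⟨fun j => h.1 (e j), fun i j hij a b hab => h.2 (e i) (e j) (fun hh => hij (he hh)) a b hab⟩

/-- The size `‖·‖_N` of a subsystem is at most that of the system (it is a sub-sum of
non-negative terms). [cite: GreenTao2010, (1.1)] -/
theorem affLinSize_comp_le {k : ℕ} (Ψ : Fin t → AffLinForm d) {e : Fin k → Fin t}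
    (he : Function.Injective e) (N : ℝ) : affLinSize (Ψ ∘ e) N ≤ affLinSize Ψ N := by
  have key : ∀ g : Fin t → ℝ, (∀ i, 0 ≤ g i) → ∑ i : Fin k, g (e i) ≤ ∑ i, g i := by
    intro g hg
    calc ∑ i : Fin k, g (e i) = ∑ i ∈ Finset.univ.map ⟨e, he⟩, g i := by
          rw [Finset.sum_map]; rfl
      _ ≤ ∑ i, g i :=
          Finset.sum_le_sum_of_subset_of_nonneg (Finset.subset_univ _) fun i _ _ => hg i
  unfold affLinSize
  exact add_le_add (key (fun i => ∑ j, |((Ψ i).coeff j : ℝ)|) fun i =>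
      Finset.sum_nonneg fun j _ => abs_nonneg _)
    (key (fun i => |((Ψ i).const : ℝ) / N|) fun i => abs_nonneg _)

open Classical in
/-- The number of lattice points `#(K ∩ ℤ^d)` of a body `K ⊆ [-N, N]^d` (counted among the
lattice points of the box, cf. `vonMangoldtSum`). [cite: GreenTao2010, (1.3)] -/
def latticePointCount (K : Set (Fin d → ℝ)) (N : ℕ) : ℕ :=
  #((latticeBox d N).filter fun n => realPoint n ∈ K)

/-! ### The level-`s` statements (conclusions of Thms. 4.5, 5.1, 5.2, 7.2) -/

/-- **Primes in affine lattices in normal form, level `s`** (the conclusion of Green–Tao 2010,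
Thm. 4.5, i.e. (4.2) `∑_{n ∈ K ∩ ℤ^d} (∏_{i ∈ [t]} Λ(ψᵢ(n)) - ∏_p β_p) = o(N^d)`, as printed:
"Let `s ≥ 1`, and let `Ψ : ℤ^d → ℤ^t` be a system of affine-linear forms of complexity `s` in
`s`-normal form. Suppose that [`GI(s)`, `MN(s)`]. Let `N > 1` and suppose that `‖Ψ‖_N = O(1)`.
Let `K ⊆ [-N,N]^t` [sc. `[-N,N]^d`] be a convex body such that `ψ₁, …, ψ_t > N^{8/10}` on `K`.
Then (4.2) holds."). Rendered uniformly in `Ψ` (standing hypotheses of Def. 1.1, `s`-normal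
form, `‖Ψ‖_N ≤ L`; see the module docstring for the complexity hypothesis) and in `K`.
[cite: GreenTao2010, Thm. 4.5] -/
def GreenTao2010_mainNormalFormAt (s : ℕ) : Prop :=
  ∀ (d t L : ℕ), 1 ≤ d → 1 ≤ t → ∀ ε : ℝ, 0 < ε → ∃ N₀ : ℕ, ∀ N : ℕ, N₀ ≤ N →
    ∀ Ψ : Fin t → AffLinForm d, IsNondegenerateSystem Ψ → IsNormalForm s Ψ →
      affLinSize Ψ N ≤ L →
      ∀ K : Set (Fin d → ℝ), Convex ℝ K → K ⊆ realBox d N →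
        (∀ x ∈ K, ∀ i, (N : ℝ) ^ ((8 : ℝ) / 10) < (Ψ i).realEval x) →
        |vonMangoldtSum Ψ K N - latticePointCount K N * singularProduct Ψ| ≤ ε * (N : ℝ) ^ d

open Classical in
/-- **`W`-tricked primes in affine lattices, level `s`** (the conclusion of Green–Tao 2010,
Thm. 5.1, as printed: "Let `s ≥ 1`, and suppose that `Ψ = (ψ₁, …, ψ_t) : ℤ^d → ℤ^t` is a system
of affine-linear forms in `s`-normal form and with `‖Ψ‖_N = O(1)`. Suppose that [`GI(s)`,
`MN(s)`]. Let `K ⊆ [-N,N]^t` [sc. `^d`] be any convex body on which `ψ₁, …, ψ_t > N^{7/10}`.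
Then for any `b₁, …, b_t ∈ [W]` which are coprime to `W`, we have
`∑_{n ∈ K ∩ ℤ^d} (∏_{i ∈ [t]} Λ'_{bᵢ,W}(ψᵢ(n)) - 1) = o(N^d)`." with the Remark: "the bounds on
the right do not depend on `b₁, …, b_t`"). `W = ∏_{p ≤ w} p` with the cutoff `w` in the
range-uniform rendering. [cite: GreenTao2010, Thm. 5.1] -/
def GreenTao2010_wTrickedAt (s : ℕ) : Prop :=
  ∀ (d t L : ℕ), 1 ≤ d → 1 ≤ t → ∀ ε : ℝ, 0 < ε → ∃ w₀ N₀ : ℕ, ∀ N : ℕ, N₀ ≤ N →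
    ∀ w : ℕ, w₀ ≤ w → (w : ℝ) ≤ Real.log (Real.log N) / 2 →
    ∀ Ψ : Fin t → AffLinForm d, IsNondegenerateSystem Ψ → IsNormalForm s Ψ →
      affLinSize Ψ N ≤ L →
      ∀ K : Set (Fin d → ℝ), Convex ℝ K → K ⊆ realBox d N →
        (∀ x ∈ K, ∀ i, (N : ℝ) ^ ((7 : ℝ) / 10) < (Ψ i).realEval x) →
        ∀ b : Fin t → ℕ,
          (∀ i, 1 ≤ b i ∧ b i ≤ primorial w ∧ Nat.Coprime (b i) (primorial w)) →
          |∑ n ∈ (latticeBox d N).filter (fun n => realPoint n ∈ K),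
              ((∏ i, vonMangoldtW (primorial w) (b i) ((Ψ i).eval n).toNat) - 1)| ≤
            ε * (N : ℝ) ^ d

open Classical in
/-- **Final technical reduction, level `s`** (the conclusion of Green–Tao 2010, Thm. 5.2, as
printed: "Let `s ≥ 1`, and let `Ψ = (ψ₁, …, ψ_t) : ℤ^d → ℤ^t` be a system of affine-linear
forms in `s`-normal form. Suppose that [`GI(s)`, `MN(s)`]. Let `K ⊆ [-N,N]^t` [sc. `^d`] be any
convex body on which `ψ₁, …, ψ_t > N^{7/10}`. Then for any `b₁, …, b_t ∈ [W]` which are coprime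
to `W`, we have `∑_{n ∈ K ∩ ℤ^d} ∏_{i ∈ [t]} (Λ'_{bᵢ,W}(ψᵢ(n)) - 1) = o(N^d)`."), with
`‖Ψ‖_N ≤ L` (implicit in the `o()`-convention of §3). [cite: GreenTao2010, Thm. 5.2] -/
def GreenTao2010_wTrickedProductAt (s : ℕ) : Prop :=
  ∀ (d t L : ℕ), 1 ≤ d → 1 ≤ t → ∀ ε : ℝ, 0 < ε → ∃ w₀ N₀ : ℕ, ∀ N : ℕ, N₀ ≤ N →
    ∀ w : ℕ, w₀ ≤ w → (w : ℝ) ≤ Real.log (Real.log N) / 2 →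
    ∀ Ψ : Fin t → AffLinForm d, IsNondegenerateSystem Ψ → IsNormalForm s Ψ →
      affLinSize Ψ N ≤ L →
      ∀ K : Set (Fin d → ℝ), Convex ℝ K → K ⊆ realBox d N →
        (∀ x ∈ K, ∀ i, (N : ℝ) ^ ((7 : ℝ) / 10) < (Ψ i).realEval x) →
        ∀ b : Fin t → ℕ,
          (∀ i, 1 ≤ b i ∧ b i ≤ primorial w ∧ Nat.Coprime (b i) (primorial w)) →
          |∑ n ∈ (latticeBox d N).filter (fun n => realPoint n ∈ K),
              ∏ i, (vonMangoldtW (primorial w) (b i) ((Ψ i).eval n).toNat - 1)| ≤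
            ε * (N : ℝ) ^ d

/-- **Gowers uniformity estimate, level `s`** (Green–Tao 2010, Thm. 7.2:
`‖Λ'_{b,W} - 1‖_{U^{s+1}[N]} = o(1)`), the level-`s` slice of
`GreenTao2010_gowersUniformity` (`GreenTao2010_gowersUniformity_iff`).
[cite: GreenTao2010, Thm. 7.2] -/
def GreenTao2010_gowersUniformityAt (s : ℕ) : Prop :=
  ∀ ε : ℝ, 0 < ε → ∃ w₀ N₀ : ℕ, ∀ N : ℕ, N₀ ≤ N → ∀ w : ℕ, w₀ ≤ w →
    (w : ℝ) ≤ Real.log (Real.log N) / 2 →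
      ∀ b : ℕ, 1 ≤ b → b ≤ primorial w → Nat.Coprime b (primorial w) →
        uniformityNorm (s + 1) N (vonMangoldtWSubOne (primorial w) b) ≤ ε

/-- `GreenTao2010_gowersUniformity` is the conjunction of its level-`s` slices, `s ≥ 1`.
[cite: GreenTao2010, Thm. 7.2] -/
theorem GreenTao2010_gowersUniformity_iff :
    GreenTao2010_gowersUniformity ↔ ∀ s : ℕ, 1 ≤ s → GreenTao2010_gowersUniformityAt s :=
  Iff.rfl

/-! ### The printed reductions -/

/-- **§4: the Main Theorem from the normal-form statements** (Green–Tao 2010, §4: "Elimination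
of the archimedean factor" — intersect `K` with `Ψ⁻¹((ℝ⁺)ᵗ)`, use (1.3) and the boundedness of
`∏_p β_p`, and discard the region `0 ≤ ψᵢ ≤ N^{9/10}` estimating `Λ` crudely by `log N`
(reduction to Thm. 4.1); "Normal form reduction": Lemma 4.4 (every system of finite complexity
`s` has an `s`-normal form extension `Ψ'` on `ℤ^{d'}`, `d' = O(1)`, `‖Ψ'‖_N = O(1)`, Def. 4.3)
and "Proof of the Main Theorem assuming Theorem 4.5" (`β'_p = β_p`, `K'`, change of variables,
division by `(2N+1)^{d'-d}`); together with Lemma 1.6 (finite complexity iff no two forms are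
affinely related, in which case the complexity is at most `t - 2`) and "the case `s = 0` follows
from the `s = 1` case"). Rendered: the level-`s` normal-form statements for all `s ≥ 1` imply the
generalised Hardy–Littlewood asymptotic for all systems of finite complexity.
[cite: GreenTao2010, §4 (Thm. 4.1, Lemma 4.4, Thm. 4.5, Proof of the Main Theorem assuming
Theorem 4.5) and Lemma 1.6] -/
def GreenTao2010_main_of_mainNormalForm : Prop :=
  (∀ s : ℕ, 1 ≤ s → GreenTao2010_mainNormalFormAt s) → GreenTaoZiegler2012_finiteComplexity

/-- **§5: Thm. 4.5 from Thm. 5.1, the `W`-trick** (Green–Tao 2010, "Proof of the Main Theorem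
assuming Theorem 5.1", pp. 1775–1776: replace `Λ` by `Λ'`; `∏_p β_p = β_W + o(1)` by Lemma 1.3
and multiplicativity; split `n = W n' + a`, `a ∈ [W]^d`, discard `a ∉ A` (`ψᵢ ≥ N^{8/10}`),
write `ψᵢ(W n + a) = W ψ̃_{i,a}(n) + bᵢ(a)`, apply Thm. 5.1 at scale `Ñ = O(N/W)` to `ψ̃`,
`K̃ = (K - a)/W`, and finish by volume packing (App. A)). Level by level.
[cite: GreenTao2010, §5 (Proof of the Main Theorem assuming Theorem 5.1)] -/
def GreenTao2010_mainNormalForm_of_wTricked : Prop :=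
  ∀ s : ℕ, 1 ≤ s → GreenTao2010_wTrickedAt s → GreenTao2010_mainNormalFormAt s

/-- **§7: Thm. 5.2 from Thm. 7.2** (Green–Tao 2010, "Proof of Main Theorem assuming Theorem 7.2":
enlarge `N` by a factor `O(1)` so that `Ψ(K) ⊆ [N]^t`; with `D = D_{s,t,d,L}` from Prop. 7.1
(generalised von Neumann theorem, App. C) and `C = max(C₁, C₀(D))`, pick a prime
`N' ∈ [CN, 2CN]` (Bertrand); by Prop. 6.4 (App. D) the functions `c · (Λ'_{bᵢ,W} - 1)` are
dominated by a `D`-pseudorandom measure `ν` on `[N^{3/5}, N]`; apply Thm. 7.2 and Prop. 7.1).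
Level by level. [cite: GreenTao2010, §7 (Proof of Main Theorem assuming Theorem 7.2), Prop. 6.4,
Prop. 7.1] -/
def GreenTao2010_wTrickedProduct_of_gowersUniformity : Prop :=
  ∀ s : ℕ, 1 ≤ s → GreenTao2010_gowersUniformityAt s → GreenTao2010_wTrickedProductAt s

/-! ### Thm. 5.1 from Thm. 5.2 (proved) -/

/-- Expanding the product: `∏ᵢ Λᵢ - 1 = ∑_{∅ ≠ T ⊆ [t]} ∏_{i ∈ T} (Λᵢ - 1)` ("splitting each
`Λ'_{bᵢ,W}` as `(Λ'_{bᵢ,W} - 1) + 1`, expanding out the product").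
[cite: GreenTao2010, §5 (after Thm. 5.2)] -/
theorem prod_sub_one_eq_sum_powerset_erase (f : Fin t → ℝ) :
    (∏ i, f i) - 1 =
      ∑ T ∈ (Finset.univ : Finset (Fin t)).powerset.erase ∅, ∏ i ∈ T, (f i - 1) := by
  have h : ∏ i, f i = ∑ T ∈ (Finset.univ : Finset (Fin t)).powerset, ∏ i ∈ T, (f i - 1) := by
    rw [← Finset.prod_add_one]
    exact Finset.prod_congr rfl fun i _ => (sub_add_cancel (f i) 1).symm
  rw [h, ← Finset.add_sum_erase _ _ (Finset.empty_mem_powerset _), Finset.prod_empty,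
    add_sub_cancel_left]

open Classical in
/-- **Thm. 5.1 from Thm. 5.2** (Green–Tao 2010, §5, the paragraph after Thm. 5.2, as printed:
"Indeed, Theorem 5.1 follows immediately from Theorem 5.2 by splitting each `Λ'_{bᵢ,W}` as
`(Λ'_{bᵢ,W} - 1) + 1`, expanding out the product in Theorem 5.1, and using Theorem 5.2
repeatedly, noting that any subsystem of `Ψ` will still be in `s`-normal form."). Proof as
printed: the `2^t - 1` non-empty subsystems are reindexed by `Fin k`, `1 ≤ k ≤ t`, and Thm. 5.2
is applied to each with `ε / 2^t` (its thresholds depend only on `d, k, L, ε`).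
[cite: GreenTao2010, §5 (after Thm. 5.2)] -/
theorem GreenTao2010_wTricked_of_wTrickedProduct (s : ℕ)
    (h : GreenTao2010_wTrickedProductAt s) : GreenTao2010_wTrickedAt s := by
  intro d t L hd ht ε hε
  -- Thresholds of Thm. 5.2 for subsystems of `k` forms, tolerance `ε / 2^t`.
  have hk : ∀ k : ℕ, ∃ w₀ N₀ : ℕ, 1 ≤ k → ∀ N : ℕ, N₀ ≤ N → ∀ w : ℕ, w₀ ≤ w →
      (w : ℝ) ≤ Real.log (Real.log N) / 2 →
      ∀ Ψ : Fin k → AffLinForm d, IsNondegenerateSystem Ψ → IsNormalForm s Ψ →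
        affLinSize Ψ N ≤ L → ∀ K : Set (Fin d → ℝ), Convex ℝ K → K ⊆ realBox d N →
          (∀ x ∈ K, ∀ i, (N : ℝ) ^ ((7 : ℝ) / 10) < (Ψ i).realEval x) →
          ∀ b : Fin k → ℕ,
            (∀ i, 1 ≤ b i ∧ b i ≤ primorial w ∧ Nat.Coprime (b i) (primorial w)) →
            |∑ n ∈ (latticeBox d N).filter (fun n => realPoint n ∈ K),
                ∏ i, (vonMangoldtW (primorial w) (b i) ((Ψ i).eval n).toNat - 1)| ≤
              ε / 2 ^ t * (N : ℝ) ^ d := by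
    intro k
    by_cases hk1 : 1 ≤ k
    · obtain ⟨w₀, N₀, H⟩ := h d k L hd hk1 (ε / 2 ^ t) (by positivity)
      exact ⟨w₀, N₀, fun _ => H⟩
    · exact ⟨0, 0, fun h1 => absurd h1 hk1⟩
  choose w₀f N₀f hf using hk
  refine ⟨(Finset.range (t + 1)).sup w₀f, (Finset.range (t + 1)).sup N₀f, ?_⟩
  intro N hN w hw hwN Ψ hΨ hnf hL K hK hKN hpos b hb
  have hexp : ∀ n : Fin d → ℤ,
      (∏ i, vonMangoldtW (primorial w) (b i) ((Ψ i).eval n).toNat) - 1 =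
        ∑ T ∈ (Finset.univ : Finset (Fin t)).powerset.erase ∅,
          ∏ i ∈ T, (vonMangoldtW (primorial w) (b i) ((Ψ i).eval n).toNat - 1) :=
    fun n => prod_sub_one_eq_sum_powerset_erase _
  simp_rw [hexp]
  rw [Finset.sum_comm]
  -- Each non-empty subsystem contributes at most `ε / 2^t · N^d`.
  have hT : ∀ T ∈ (Finset.univ : Finset (Fin t)).powerset.erase ∅,
      |∑ n ∈ (latticeBox d N).filter (fun n => realPoint n ∈ K),
          ∏ i ∈ T, (vonMangoldtW (primorial w) (b i) ((Ψ i).eval n).toNat - 1)| ≤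
        ε / 2 ^ t * (N : ℝ) ^ d := by
    intro T hTP
    have hTne : T ≠ ∅ := (Finset.mem_erase.mp hTP).1
    obtain ⟨k, hk⟩ : ∃ k, T.card = k := ⟨_, rfl⟩
    have hk1 : 1 ≤ k := by
      rw [← hk]
      exact Finset.card_pos.mpr (Finset.nonempty_iff_ne_empty.mpr hTne)
    have hkt : k ≤ t := by
      have := T.card_le_univ
      rw [Fintype.card_fin, hk] at this
      exact this
    let e : Fin k ↪o Fin t := T.orderEmbOfFin hk
    have hprod : ∀ n : Fin d → ℤ,
        ∏ i ∈ T, (vonMangoldtW (primorial w) (b i) ((Ψ i).eval n).toNat - 1) =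
          ∏ j : Fin k, (vonMangoldtW (primorial w) (b (e j)) ((Ψ (e j)).eval n).toNat - 1) := by
      intro n
      have hmap := Finset.prod_map (Finset.univ : Finset (Fin k)) e.toEmbedding
        fun i => vonMangoldtW (primorial w) (b i) ((Ψ i).eval n).toNat - 1
      rw [Finset.map_orderEmbOfFin_univ T hk] at hmap
      exact hmap
    simp_rw [hprod]
    have hw₀ : w₀f k ≤ w :=
      le_trans (Finset.le_sup (f := w₀f) (Finset.mem_range.mpr (Nat.lt_succ_of_le hkt))) hw
    have hN₀ : N₀f k ≤ N :=
      le_trans (Finset.le_sup (f := N₀f) (Finset.mem_range.mpr (Nat.lt_succ_of_le hkt))) hN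
    exact hf k hk1 N hN₀ w hw₀ hwN (Ψ ∘ e) (hΨ.comp_of_injective e.injective)
      (hnf.comp_of_injective e.injective) ((affLinSize_comp_le Ψ e.injective N).trans hL) K hK
      hKN (fun x hx j => hpos x hx (e j)) (fun j => b (e j)) fun j => hb (e j)
  have hcard : (((Finset.univ : Finset (Fin t)).powerset.erase ∅).card : ℝ) ≤ 2 ^ t := by
    have h1 : ((Finset.univ : Finset (Fin t)).powerset.erase ∅).card ≤ 2 ^ t :=
      Finset.card_erase_le.trans (by simp)
    exact_mod_cast h1
  have hεN : 0 ≤ ε / 2 ^ t * (N : ℝ) ^ d := by positivity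
  calc |∑ T ∈ (Finset.univ : Finset (Fin t)).powerset.erase ∅,
          ∑ n ∈ (latticeBox d N).filter (fun n => realPoint n ∈ K),
            ∏ i ∈ T, (vonMangoldtW (primorial w) (b i) ((Ψ i).eval n).toNat - 1)|
      ≤ ∑ T ∈ (Finset.univ : Finset (Fin t)).powerset.erase ∅,
          |∑ n ∈ (latticeBox d N).filter (fun n => realPoint n ∈ K),
            ∏ i ∈ T, (vonMangoldtW (primorial w) (b i) ((Ψ i).eval n).toNat - 1)| :=
        Finset.abs_sum_le_sum_abs _ _
    _ ≤ ∑ T ∈ (Finset.univ : Finset (Fin t)).powerset.erase ∅, ε / 2 ^ t * (N : ℝ) ^ d :=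
        Finset.sum_le_sum hT
    _ = ((Finset.univ : Finset (Fin t)).powerset.erase ∅).card * (ε / 2 ^ t * (N : ℝ) ^ d) := by
        rw [Finset.sum_const, nsmul_eq_mul]
    _ ≤ 2 ^ t * (ε / 2 ^ t * (N : ℝ) ^ d) := mul_le_mul_of_nonneg_right hcard hεN
    _ = ε * (N : ℝ) ^ d := by
        field_simp

/-! ### Assembly -/

/-- The three printed reductions (§4, §5, §7), together with the proved reduction
Thm. 5.2 ⇒ Thm. 5.1, give the transference `GreenTao2010_transference` (Thm. 7.2 for all `s ≥ 1`
implies the Main Theorem for systems of finite complexity).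
[cite: GreenTao2010, §§4–7] -/
theorem GreenTao2010_transference_of_reductions (h₁ : GreenTao2010_main_of_mainNormalForm)
    (h₂ : GreenTao2010_mainNormalForm_of_wTricked)
    (h₃ : GreenTao2010_wTrickedProduct_of_gowersUniformity) : GreenTao2010_transference :=
  fun hU => h₁ fun s hs => h₂ s hs (GreenTao2010_wTricked_of_wTrickedProduct s
    (h₃ s hs (GreenTao2010_gowersUniformity_iff.mp hU s hs)))

/-- Assembly of the whole printed architecture down to this layer: the reductions of §§4, 5, 7
and the Gowers uniformity estimate Thm. 7.2 (with `GI(s)` from Green–Tao–Ziegler 2012 and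
`MN(s)` from Green–Tao 2012) give the Green–Tao–Ziegler theorem.
[cite: GreenTao2010, Main Theorem] [cite: GreenTaoZiegler2012, Thm. 1.3 and the following
paragraph] -/
theorem GreenTaoZiegler2012_finiteComplexity_of_reductions
    (h₁ : GreenTao2010_main_of_mainNormalForm) (h₂ : GreenTao2010_mainNormalForm_of_wTricked)
    (h₃ : GreenTao2010_wTrickedProduct_of_gowersUniformity)
    (hU : GreenTao2010_gowersUniformity) : GreenTaoZiegler2012_finiteComplexity :=
  GreenTaoZiegler2012_finiteComplexity_of_transference
    (GreenTao2010_transference_of_reductions h₁ h₂ h₃) hU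

end Literature.NumberTheory.Sieve
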